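import Summits.BirchSwinnertonDyer.Rank1Residual.GaloisImage.KolyvaginDerivativeInvariantModulo
import Summits.BirchSwinnertonDyer.Rank1Residual.GaloisImage.KolyvaginDerivativeClasses
import HarnessLib

/-!
# `(g − 1) · D_r c_r ∈ 𝔞_r • W` for every Galois-stable submodule `W ∋ res c_s` of `H¹(U_r, T)`
# — Rubin's Lemma 4.4.2 BEFORE reduction, for the tree's `IsEulerSystem` (file U3 of the proposed
# row T-DER-BU; cell `b2b-bsdres`, team n1011, seat p15 GEN 27 — custodian by-product, OFFERED)

HONEST FRAMING (cell `b2b-bsdres`, run/shared/lean/b2b/bsd-rank1-residual/, verbatim in every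
file): the goal of the cell is to DELETE the COMBINATION-SHAPED residual classes of the
Birch–Swinnerton-Dyer formula for ALL analytic-rank `≤ 1` elliptic curves over `ℚ` — "full BSD
formula for every rank `≤ 1` curve in class `C`" assembled STRICTLY from published theorems — so
that the rank-`≤ 1` remainder becomes exactly the CONSTRUCTION-SHAPED classes, which are TYPED
(missing-input `Prop`s), NOT attempted. This is not "finishing BSD". Team n1011 (N10 / N11, the
additive block X4 ∧ `p = 3`): research route on the CONSTRUCTION-SHAPED class X4; no claim beyond the
stated classes; nothing is booked. TOOL theorems of continuous Galois cohomology (no definition, no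
named fact, no `sorry`); curve-free and `p`-free.

## What

F3b (`KolyvaginDerivativeClasses`, n1011-p11) proves `g · D_r (red_* c_r) = D_r (red_* c_r)` in
`H¹(U_r, T′)` for `T′` KILLED by `N_ℓ` and `P_ℓ(1)`.  Here, with the SAME data (an Euler system `c`,
generators `σ_ℓ` with `hσp`/`hσ`/`hcov`/`hinj`, arithmetic Frobenii `Fr_ℓ` in the `p`-level, the
levels ramified at `ℓ`) but WITHOUT reducing the coefficients: for every `A`-submodule
`W ≤ H¹(U_r, T)` stable under the action of `Γ_K` and containing the restricted classes
`res^{U_s}_{U_r} c_{i,s}` (`s ⊆ r`), and every ideal `𝔞 ∋ N_ℓ, P_ℓ(1)` (`ℓ ∈ r`):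

* `conjMap_sub_mem_of_forall_sigma` — if `σ_q · y − y ∈ J` for all `q ∈ r` and `J` is `Γ_K`-stable
  then `g · y − y ∈ J` for every `g` of the `p`-level (the `σ_q` generate it modulo `U_r`);
* **`conjMap_deriv_sub_deriv_mem_smul`: `g · D_r c_{i,r} − D_r c_{i,r} ∈ 𝔞 • W`** for every `g` in
  the `p`-level — U1's abstract induction (`sub_mem_noncommProd_deriv_of_eulerFamily_mod`) fed with
  F3a's INTEGRAL norm relations `sum_conjMap_pow_resLe_eq_eulerFactorOp`.

Intended instance (file U5): `W` = the classes unramified at every prime over a place `w ∤ p`,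
`w ∉ r` (Galois-stable; contains the `c_{i,s}` by Kato (8.1.3) = `ZetaBody` (C2)); then
`g · D_r c_r − D_r c_r` is an `𝔞_r`-combination of UNRAMIFIED classes, the input `hwit` of U2's
unramified descent (`exists_rep_sub_coboundary_eq_red_invariant`): [MR04] Remark A.5.

References: K. Rubin, *Euler Systems* (2000), Def. 4.4.1, Lemma 4.4.2; B. Mazur, K. Rubin,
*Kolyvagin systems*, Mem. AMS 799 (2004), App. A (34)–(35) (p. 83), Remark A.5 (p. 81); design
`HOME/b2b-bsdres-n1011-p15/g27/T-DER-BU-SCOPING.md`.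
-/

noncomputable section

open CategoryTheory Function Finset Polynomial Field IsDedekindDomain
open scoped NumberField Classical
open Literature.NumberTheory.GaloisRepresentations

universe u v w

namespace Summit.BirchSwinnertonDyer.Rank1Residual.GaloisImage

namespace Derivative

section Integral

variable {K : Type u} [Field K] [NumberField K] {ι : Type w} [Preorder ι] [OrderBot ι]
variable {A : Type v} [CommRing A] [TopologicalSpace A]
variable {M : Type u} [AddCommGroup M] [Module A M] [TopologicalSpace M] [IsTopologicalAddGroup M]
  [ContinuousSMul A M] [Module.Free A M] [Module.Finite A M]
variable {L : EulerSystemLevels K ι} {T : GaloisRep K A M} {p : ℕ} [Fact p.Prime] [Algebra ℤ_[p] A]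
variable {c : ∀ (i : ι) (r : L.Ideals), H1 T (L.level i r.1)}

omit [Module.Free A M] [Module.Finite A M] in
/-- **From the generators to the whole `p`-level, modulo a stable submodule.**  If `J ≤ H¹(U_r, T)`
is stable under the action of `Γ_K` and `σ_q · y − y ∈ J` for every chosen generator `σ_q`
(`q ∈ r`), then `g · y − y ∈ J` for every `g` of the `p`-level: the `σ_q` generate `Γ_K` modulo
`U_r` (F3a `exists_mem_closure_inv_mul_mem`) and `(ab)·y − y = a·(b·y − y) + (a·y − y)`,
`a⁻¹·y − y = −a⁻¹·(a·y − y)`.  The congruence form of F3b's `conjMap_eq_self_of_forall_sigma`.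
[folklore] -/
theorem conjMap_sub_mem_of_forall_sigma (i : ι) (r : Finset (HeightOneSpectrum (𝓞 K)))
    (σ : HeightOneSpectrum (𝓞 K) → absoluteGaloisGroup K) (N : HeightOneSpectrum (𝓞 K) → ℕ)
    (hσp : ∀ ℓ ∈ r, σ ℓ ∈ L.pLevel i)
    (hσ : ∀ ℓ ∈ r, ∀ q ∈ r, q ≠ ℓ → σ ℓ ∈ L.tameLevel q)
    (hcov : ∀ ℓ ∈ r, ∀ g : absoluteGaloisGroup K, ∃ j < N ℓ, (σ ℓ ^ j)⁻¹ * g ∈ L.tameLevel ℓ)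
    (J : Submodule A (H1 T (L.level i r)))
    (hJ : ∀ g : absoluteGaloisGroup K, ∀ z ∈ J, conjMap T.toTopRep (L.level i r) g 1 z ∈ J)
    (y : H1 T (L.level i r))
    (hy : ∀ q ∈ r, conjMap T.toTopRep (L.level i r) (σ q) 1 y - y ∈ J) (g : absoluteGaloisGroup K)
    (hg : g ∈ L.pLevel i) :
    conjMap T.toTopRep (L.level i r) g 1 y - y ∈ J := by
  obtain ⟨w, hw, hwq⟩ := exists_mem_closure_inv_mul_mem L σ N r hσ hcov g
  have hfix : ∀ w ∈ Subgroup.closure (σ '' (r : Set (HeightOneSpectrum (𝓞 K)))),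
      conjMap T.toTopRep (L.level i r) w 1 y - y ∈ J ∧ w ∈ L.pLevel i := by
    intro w hw
    induction hw using Subgroup.closure_induction with
    | mem x hx =>
      obtain ⟨q, hq, rfl⟩ := hx
      exact ⟨hy q (Finset.mem_coe.mp hq), hσp q (Finset.mem_coe.mp hq)⟩
    | one =>
      refine ⟨?_, Subgroup.one_mem _⟩
      rw [conjMap_one_one, sub_self]
      exact J.zero_mem
    | mul a b _ _ iha ihb =>
      refine ⟨?_, Subgroup.mul_mem _ iha.2 ihb.2⟩
      have e : conjMap T.toTopRep (L.level i r) (a * b) 1 y - y =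
          conjMap T.toTopRep (L.level i r) a 1 (conjMap T.toTopRep (L.level i r) b 1 y - y) +
            (conjMap T.toTopRep (L.level i r) a 1 y - y) := by
        rw [map_sub, conjMap_conjMap]; abel
      rw [e]
      exact J.add_mem (hJ a _ ihb.1) iha.1
    | inv a _ iha =>
      refine ⟨?_, Subgroup.inv_mem _ iha.2⟩
      have e : conjMap T.toTopRep (L.level i r) a⁻¹ 1 y - y =
          -(conjMap T.toTopRep (L.level i r) a⁻¹ 1 (conjMap T.toTopRep (L.level i r) a 1 y - y)) := by
        rw [map_sub, conjMap_conjMap, inv_mul_cancel, conjMap_one_one]; abel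
      rw [e]
      exact J.neg_mem (hJ a⁻¹ _ iha.1)
  obtain ⟨hwfix, hwp⟩ := hfix w hw
  have hmem : w⁻¹ * g ∈ L.level i r :=
    mem_level_of_forall L (Subgroup.mul_mem _ (Subgroup.inv_mem _ hwp) hg) hwq
  rw [conjMap_eq_conjMap_of_inv_mul_mem T.toTopRep hmem]
  exact hwfix

omit [TopologicalSpace A] [Module.Free A M] [Module.Finite A M] in
/-- Stability of `𝔞 • W` under an `A`-linear map preserving `W`. [folklore] -/
theorem map_mem_smul_of_forall_mem {X : Type*} [AddCommGroup X] [Module A X] (W : Submodule A X)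
    (𝔞 : Ideal A) (f : X →ₗ[A] X) (hf : ∀ y ∈ W, f y ∈ W) (z : X) (hz : z ∈ 𝔞 • W) :
    f z ∈ 𝔞 • W := by
  refine Submodule.smul_induction_on (p := fun z => f z ∈ 𝔞 • W) hz (fun a ha y hy => ?_)
    (fun z₁ z₂ h₁ h₂ => ?_)
  · rw [map_smul]; exact Submodule.smul_mem_smul ha (hf y hy)
  · rw [map_add]; exact Submodule.add_mem _ h₁ h₂

/-- **`g · D_r c_{i,r} − D_r c_{i,r} ∈ 𝔞 • W`** — Rubin's Lemma 4.4.2 before reduction (module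
docstring): for an Euler system `c` with the generator / Frobenius data of F3b, an ideal `𝔞` of `A`
containing every `N_ℓ` and `P_ℓ(1)` (`ℓ ∈ r`), and a `Γ_K`-stable `A`-submodule `W` of
`H¹(U_r, T)` containing `res c_{i,s}` for all `s ⊆ r`, the derivative `D_r c_{i,r}` is invariant
MODULO `𝔞 • W` under every `g` of the `p`-level.  Proof: U1's
`sub_mem_noncommProd_deriv_of_eulerFamily_mod` on the Euler family `x_s = res c_{i,s}` in
`X = H¹(U_r, T)` (norm relations F3a `sum_conjMap_pow_resLe_eq_eulerFactorOp`, `J = 𝔞 • W`), then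
`conjMap_sub_mem_of_forall_sigma`. [cite: Rubin2000, Lemma 4.4.2]
[cite: MazurRubin2004, App. A (34)–(35) (p. 83) and Remark A.5 (p. 81)] -/
theorem conjMap_deriv_sub_deriv_mem_smul (hc : IsEulerSystem L T p c) (i : ι) (r : L.Ideals)
    (σ : HeightOneSpectrum (𝓞 K) → absoluteGaloisGroup K) (N : HeightOneSpectrum (𝓞 K) → ℕ)
    (Fr : HeightOneSpectrum (𝓞 K) → absoluteGaloisGroup K)
    (hσp : ∀ ℓ ∈ r.1, σ ℓ ∈ L.pLevel i)
    (hσ : ∀ ℓ ∈ r.1, ∀ q ∈ r.1, q ≠ ℓ → σ ℓ ∈ L.tameLevel q)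
    (hcov : ∀ ℓ ∈ r.1, ∀ g : absoluteGaloisGroup K, ∃ j < N ℓ, (σ ℓ ^ j)⁻¹ * g ∈ L.tameLevel ℓ)
    (hinj : ∀ ℓ ∈ r.1, ∀ j₁ < N ℓ, ∀ j₂ < N ℓ, (σ ℓ ^ j₁)⁻¹ * σ ℓ ^ j₂ ∈ L.tameLevel ℓ → j₁ = j₂)
    (hFrp : ∀ ℓ ∈ r.1, Fr ℓ ∈ L.pLevel i) (hFr : ∀ ℓ ∈ r.1, IsArithFrobAtPlace K ℓ (Fr ℓ))
    (hram : ∀ ℓ ∈ r.1, ∀ s ⊆ r.1, ℓ ∉ s → ¬ SubgroupIsUnramifiedAt K (L.level i (insert ℓ s)) ℓ)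
    (𝔞 : Ideal A) (hN : ∀ ℓ ∈ r.1, ((N ℓ : ℕ) : A) ∈ 𝔞)
    (hP : ∀ ℓ ∈ r.1,
      (rubinEulerFactor T.toRepresentation (cyclotomicCharacterToUnits K p A) (Fr ℓ)).eval 1 ∈ 𝔞)
    (W : Submodule A (H1 T (L.level i r.1)))
    (hW : ∀ g : absoluteGaloisGroup K, ∀ y ∈ W, conjMap T.toTopRep (L.level i r.1) g 1 y ∈ W)
    (hcW : ∀ (s : Finset (HeightOneSpectrum (𝓞 K))) (hs : s ⊆ r.1),
      resLe T.toTopRep (level_antitone L i hs) 1 (c i ⟨s, fun q hq => r.2 q (hs hq)⟩) ∈ W)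
    (comm) (g : absoluteGaloisGroup K) (hg : g ∈ L.pLevel i) :
    conjMap T.toTopRep (L.level i r.1) g 1
        ((r.1.noncommProd (fun ℓ => ∑ j ∈ range (N ℓ), (j : Module.End A (H1 T (L.level i r.1))) *
          (conjMap T.toTopRep (L.level i r.1) (σ ℓ) 1).hom.toLinearMap ^ j) comm) (c i r)) -
      (r.1.noncommProd (fun ℓ => ∑ j ∈ range (N ℓ), (j : Module.End A (H1 T (L.level i r.1))) *
          (conjMap T.toTopRep (L.level i r.1) (σ ℓ) 1).hom.toLinearMap ^ j) comm) (c i r)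
      ∈ 𝔞 • W := by
  classical
  -- notation (`U_r = L.level i r.1`)
  let X := H1 T (L.level i r.1)
  let E : HeightOneSpectrum (𝓞 K) → Module.End A X := fun ℓ =>
    (conjMap T.toTopRep (L.level i r.1) (σ ℓ) 1).hom.toLinearMap
  let F : HeightOneSpectrum (𝓞 K) → Module.End A X := fun ℓ => frobeniusInvOp T (L.level i r.1) (Fr ℓ)
  let P : HeightOneSpectrum (𝓞 K) → A[X] := fun ℓ =>
    rubinEulerFactor T.toRepresentation (cyclotomicCharacterToUnits K p A) (Fr ℓ)
  let J : Submodule A X := 𝔞 • W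
  -- `U ≤ U_s` for `s ⊆ r`, and the family
  have hUle : ∀ {s : Finset (HeightOneSpectrum (𝓞 K))}, s ⊆ r.1 → L.level i r.1 ≤ L.level i s :=
    fun hs => level_antitone L i hs
  let x : Finset (HeightOneSpectrum (𝓞 K)) → X := fun s =>
    if hs : s ⊆ r.1 then resLe T.toTopRep (hUle hs) 1 (c i ⟨s, fun q hq => r.2 q (hs hq)⟩) else 0
  have hx : ∀ {s} (hs : s ⊆ r.1),
      x s = resLe T.toTopRep (hUle hs) 1 (c i ⟨s, fun q hq => r.2 q (hs hq)⟩) :=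
    fun hs => dif_pos hs
  -- `J` is `Γ_K`-stable
  have hJ : ∀ g : absoluteGaloisGroup K, ∀ z ∈ J, conjMap T.toTopRep (L.level i r.1) g 1 z ∈ J :=
    fun g z hz => map_mem_smul_of_forall_mem W 𝔞 (conjMap T.toTopRep (L.level i r.1) g 1).hom.toLinearMap
      (hW g) z hz
  -- basic group facts
  have hσN : ∀ ℓ ∈ r.1, σ ℓ ^ N ℓ ∈ L.level i r.1 := fun ℓ hℓ =>
    mem_level_of_forall L (Subgroup.pow_mem _ (hσp ℓ hℓ) _) fun q hq => by
      by_cases hqℓ : q = ℓ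
      · subst hqℓ; exact pow_mem_tameLevel_of_cov_inj L (hcov q hq) (hinj q hq)
      · exact Subgroup.pow_mem _ (hσ ℓ hℓ q hq hqℓ) _
  have hσUs : ∀ {s} (hs : s ⊆ r.1), ∀ ℓ ∈ r.1, ℓ ∉ s → σ ℓ ∈ L.level i s :=
    fun hs ℓ hℓ hℓs => mem_level_of_forall L (hσp ℓ hℓ) fun q hq =>
      hσ ℓ hℓ q (hs hq) (fun h => hℓs (h ▸ hq))
  -- the operators commute
  have hEE : ∀ a b, Commute (E a) (E b) := fun a b => commute_conjMap_hom_level i r.1 (σ a) (σ b)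
  have hFE : ∀ a b, Commute (F a) (E b) := fun a b =>
    commute_conjMap_hom_level i r.1 (Fr a)⁻¹ (σ b)
  -- (hσW), (hFJ), (hxW)
  have hσW : ∀ a, ∀ y ∈ W, E a y ∈ W := fun a y hy => hW (σ a) y hy
  have hFJ : ∀ a, ∀ z ∈ J, F a z ∈ J := fun a z hz => hJ (Fr a)⁻¹ z hz
  have hxW : ∀ s ⊆ r.1, x s ∈ W := fun s hs => by rw [hx hs]; exact hcW s hs
  -- (hfix) `σ_ℓ` fixes `x_s` for `ℓ ∉ s`
  have hfix : ∀ s ⊆ r.1, ∀ ℓ ∈ r.1, ℓ ∉ s → E ℓ (x s) = x s := by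
    intro s hs ℓ hℓ hℓs
    rw [hx hs]
    change conjMap T.toTopRep (L.level i r.1) (σ ℓ) 1 (resLe T.toTopRep (hUle hs) 1 _) = _
    rw [← resLe_conjMap, conjMap_eq_self_of_mem T.toTopRep (hσUs hs ℓ hℓ hℓs)]
  -- (hord) `σ_ℓ^{N_ℓ}` acts trivially
  have hord : ∀ s ⊆ r.1, ∀ ℓ ∈ s, (E ℓ ^ N ℓ) (x s) = x s := by
    intro s hs ℓ hℓ
    change ((conjMap T.toTopRep (L.level i r.1) (σ ℓ) 1).hom.toLinearMap ^ N ℓ) (x s) = x s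
    rw [conjMap_hom_pow_apply, conjMap_eq_self_of_mem T.toTopRep (hσN ℓ (hs hℓ))]
  -- (hnorm) the INTEGRAL norm relations, from F3a
  have hnorm : ∀ s ⊆ r.1, ∀ ℓ ∈ s,
      (∑ j ∈ range (N ℓ), E ℓ ^ j) (x s) = aeval (F ℓ) (P ℓ) (x (s.erase ℓ)) := by
    intro s hs ℓ hℓ
    have hs' : s.erase ℓ ⊆ r.1 := (Finset.erase_subset ℓ s).trans hs
    have hℓs' : ℓ ∉ s.erase ℓ := Finset.notMem_erase ℓ s
    let r₀ : L.Ideals := ⟨s.erase ℓ, fun q hq => r.2 q (hs' hq)⟩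
    have hℓp : ℓ ∈ L.primes := r.2 ℓ (hs hℓ)
    have hcons : (r₀.cons ℓ hℓp).1 = s := Finset.insert_erase hℓ
    have hsub : (⟨s, fun q hq => r.2 q (hs hq)⟩ : L.Ideals) = r₀.cons ℓ hℓp := Subtype.ext hcons.symm
    have hUc : L.level i r.1 ≤ L.level i (r₀.cons ℓ hℓp).1 := hcons.symm ▸ hUle hs
    have hσ₀ : σ ℓ ∈ L.level i r₀.1 := hσUs hs' ℓ (hs hℓ) hℓs'
    have hcov₀ : ∀ g ∈ L.level i r₀.1, ∃ j < N ℓ, (σ ℓ ^ j)⁻¹ * g ∈ L.level i (r₀.cons ℓ hℓp).1 := by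
      intro g hg
      obtain ⟨j, hj, hjg⟩ := hcov ℓ (hs hℓ) g
      refine ⟨j, hj, ?_⟩
      rw [EulerSystemLevels.Ideals.cons_val]
      have hmem : (σ ℓ ^ j)⁻¹ * g ∈ L.level i r₀.1 :=
        Subgroup.mul_mem _ (Subgroup.inv_mem _ (Subgroup.pow_mem _ hσ₀ j)) hg
      rw [EulerSystemLevels.mem_level_iff] at hmem ⊢
      refine ⟨hmem.1, fun q hq => ?_⟩
      rcases Finset.mem_insert.mp hq with rfl | hq
      · exact hjg
      · exact hmem.2 q hq
    have hinj₀ : ∀ j₁ < N ℓ, ∀ j₂ < N ℓ,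
        (σ ℓ ^ j₁)⁻¹ * σ ℓ ^ j₂ ∈ L.level i (r₀.cons ℓ hℓp).1 → j₁ = j₂ := by
      intro j₁ hj₁ j₂ hj₂ hmem
      rw [EulerSystemLevels.Ideals.cons_val, EulerSystemLevels.mem_level_iff] at hmem
      exact hinj ℓ (hs hℓ) j₁ hj₁ j₂ hj₂ (hmem.2 ℓ (Finset.mem_insert_self ℓ _))
    have hram₀ : ¬ SubgroupIsUnramifiedAt K (L.level i (r₀.cons ℓ hℓp).1) ℓ := by
      rw [EulerSystemLevels.Ideals.cons_val]
      exact hram ℓ (hs hℓ) (s.erase ℓ) hs' hℓs'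
    have key := sum_conjMap_pow_resLe_eq_eulerFactorOp hc i r₀ ℓ hℓp hℓs' hram₀ (Fr ℓ)
      (hFr ℓ (hs hℓ)) hUc (σ ℓ) (N ℓ) hσ₀ hcov₀ hinj₀
    rw [hx hs, hx hs', LinearMap.sum_apply]
    have hcs : resLe T.toTopRep (hUle hs) 1 (c i ⟨s, fun q hq => r.2 q (hs hq)⟩) =
        resLe T.toTopRep hUc 1 (c i (r₀.cons ℓ hℓp)) := by
      clear key hcov₀ hinj₀ hram₀
      revert hUc
      rw [← hsub]
      intro hUc
      rfl
    have hEpow : ∀ (j : ℕ) (y : X), (E ℓ ^ j) y = conjMap T.toTopRep (L.level i r.1) (σ ℓ ^ j) 1 y :=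
      fun j y => conjMap_hom_pow_apply T.toTopRep (σ ℓ) j y
    rw [Finset.sum_congr rfl fun j _ => hEpow j _, hcs]
    exact key
  -- (hN), (hP): `N_ℓ • W ⊆ J`, `P_ℓ(1) • W ⊆ J`
  have hN' : ∀ ℓ ∈ r.1, ∀ y ∈ W, (N ℓ : A) • y ∈ J := fun ℓ hℓ y hy =>
    Submodule.smul_mem_smul (hN ℓ hℓ) hy
  have hP' : ∀ ℓ ∈ r.1, ∀ y ∈ W, (P ℓ).eval 1 • y ∈ J := fun ℓ hℓ y hy =>
    Submodule.smul_mem_smul (hP ℓ hℓ) hy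
  -- (hF): `Fr_ℓ⁻¹ − 1` maps into `J` every vector all of whose `σ_q − 1` do
  have hF' : ∀ ℓ ∈ r.1, ∀ y ∈ W, (∀ q ∈ r.1, E q y - y ∈ J) → F ℓ y - y ∈ J := by
    intro ℓ hℓ y _ hyq
    change conjMap T.toTopRep (L.level i r.1) (Fr ℓ)⁻¹ 1 y - y ∈ J
    exact conjMap_sub_mem_of_forall_sigma i r.1 σ N hσp hσ hcov J hJ y hyq (Fr ℓ)⁻¹
      (Subgroup.inv_mem _ (hFrp ℓ hℓ))
  -- the abstract theorem at `s = r.1`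
  have main := sub_mem_noncommProd_deriv_of_eulerFamily_mod E F N P r.1 x W J hEE hFE hσW hFJ hxW
    hfix hord hnorm hN' hP' hF' r.1 subset_rfl
  -- `x r.1 = c i r`
  have hxr : x r.1 = c i r := by
    rw [hx subset_rfl]
    exact resLe_refl_apply T.toTopRep (c i r)
  rw [hxr] at main
  -- from the generators to `g`
  exact conjMap_sub_mem_of_forall_sigma i r.1 σ N hσp hσ hcov J hJ _ main g hg

end Integral

end Derivative

end Summit.BirchSwinnertonDyer.Rank1Residual.GaloisImage

end
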